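import Mathlib
import HarnessLib
import HarnessLib.Audit
import Summits.Langlands.Statement
import Literature.NumberTheory.Automorphic.ArtinAutomorphy
import Literature.NumberTheory.GaloisRepresentations.ArtinFormalism
import Literature.NumberTheory.Automorphic.GLnAdelicStructureProofs
import Literature.NumberTheory.Automorphic.LocalLanglandsGLProofs
import Literature.NumberTheory.Automorphic.LocalConstantsProofs

/-!
Route: DedekindDeficit1951

CLOSED (superseded) 2026-08-17T09:21:35Z by planner-rchoice-Langlands-DedekindDeficit1951--d6caad29-0 — reason: superseded:route-Langlands-DedekindQuotient1951 — superseded by route-Langlands-DedekindQuotient1951 — note: route-choice (planner-rchoice, 2026-08-17): tier judgment X rj3 03:50Z ACCEPTED — subsumed by route-Langlands-DedekindQuotient1951 (opened 32 min earlier): same mechanism (typed (B) at F=ℚ, n=4 on the ℓ-adic avatar of the 4-dim Artin constituent ρ₄ of Ind_K^ℚ 1 for the Doud–Moore totally real A₅ qui. The file is kept as the record of this route; refuted decls are indexed as negative knowledge (`ledger negatives`).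

# Route DedekindDeficit1951 — Reciprocity on GL4 forces zeta to divide a quintic Dedekind zeta;
census the Riemann zeros

NEGATION LENS `reduction-to-finite`, refutation shape (closes : ZetaNonDivisor →
CorrespondentDividesZeta → QuinticAvatarSupply → ¬Langlands). Let K = ℚ(θ) be the totally real A₅
quintic field of the Doud–Moore polynomial x⁵ − x⁴ − 780x³ + 9911x² − 24208x + 15952 (discriminant
1951⁴; the field of the first even icosahedral Galois representation, formalised in the tree for
route QuarterDeficit1951) and σ = Ind_{Γ_K}^{Γ_ℚ} 1 − 1 : Γ_ℚ → GL₄(ℤ) ⊂ GL₄(ℂ) its irreducible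
4-dimensional Artin representation, so that L(s, σ) = ζ_K(s)/ζ(s). REDUCTION THEOREM (printed:
Godement–Jacquet 1972 Thm 13.8 + Artin formalism): conjunct (B) of the typed summit at F = ℚ, n = 4,
applied to an ℓ-adic avatar ρ of σ (finite image, unramified at ℓ ≠ 1951, hence geometric for the
pinned datum) gives a CUSPIDAL π on GL₄(𝔸_ℚ) whose cofinite Satake clause alone (no local–global
compatibility, no level or archimedean pinning) makes π = π(σ) a.e.; the partial standard L-function
L^S(s, π) = L^S(s, σ) is then entire, so ζ_K has a continuation holomorphic on {Re s > 0} ∖ {1}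
vanishing at every zero of ζ in the open critical strip — Dedekind's conjecture for K/ℚ, OPEN
exactly for totally real A₅/S₅ quintics (van der Waall 1975 covers solvable closures; the
non-totally-real icosahedral case follows from odd Artin (Khare–Wintenberger) and σ_A₅ = τ ⊗ τ^c
(Ramakrishnan 2000)). X (the bet, `--computational`) = ZetaNonDivisor: some non-trivial zero s₀ of ζ
with |Im s₀| ≤ 200 has NO zero of ζ_K within 10⁻⁶ — decided EITHER way by one Arb-certified job
(smoothed approximate functional equation for ζ_K + argument principle on 79 discs). X ∧
CorrespondentDividesZeta ∧ QuinticAvatarSupply → ¬Langlands.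
Lean: `ZetaNonDivisor ∧ CorrespondentDividesZeta ∧ QuinticAvatarSupply`

## Assembly
Pure logic, refutation shape (sorry-free in Sketch.lean and glue.lean): assume `Langlands`;
specialise to F = ℚ and obtain RD; QuinticAvatarSupply gives K, σ, the induced decomposition and, at
ℓ = 17, (ι, ρ) irreducible and geometric with the avatar property; conjunct (B) at n = 4 (hcpt :=
`isCompact_glFiniteIntegralLevel_holds 4 ℚ`) gives a cuspidal L-algebraic π with `Corresponds RD ι
π.1 ρ`, hence `IsPiOfArtinRep σ π.1`; CorrespondentDividesZeta gives a continuation Z of ζ_K on {Re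
s > 0} ∖ {1} vanishing at every Riemann zero in the strip; ZetaNonDivisor (applied to K) gives a
Riemann zero s₀ at which every such continuation is non-zero on a 10⁻⁶-disc — contradiction at s =
s₀. The Assembly item records the implication; the deciding theorem is `closes`, opened with
--refutation (D-0027).

Rationale: WHY THIS LINE. The only existing negation route (QuarterDeficit1951) decides its instance through
the spectral side (Maass newform at λ = 1/4, certified Selberg trace formula) and therefore needs
the all-places clause, conductor exactness, an archimedean classification and a port of the
Booker–Lee–Strömbergsson evaluator (≈10³ core-days); this line decides an instance of the SAME
motive family through the L-function side, where the reduction theorem is Godement–Jacquet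
entireness of standard L-functions of cuspidal representations (GodementJacquet1972 Thm 13.8,
JacquetShalikaAJM1981; in tree as the named fact `godementJacquet` with the L² bridge
`exists_isAssociatedL2_holds`, `exists_centerInvariant_hasSatakeParamAt_shift_eventually`,
`exists_entire_eq_partialStandardL_of_godementJacquet`) plus the Artin formalism for induced
representations (NeukirchANT1999 VII (10.4); in tree and PROVED:
`artinLFunction_eq_of_isInducedFrom_holds`, `artinLFunction_prod`,
`artinLFunction_trivial_eq_dedekindZeta_holds`), and the certificate is an interval-arithmetic
evaluation of ONE degree-5 Dedekind zeta function at 79 Riemann zeros (≈ 80 core-days, no new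
evaluator class: Booker2006 §§3–5, Platt2017). Imported areas: analytic theory of automorphic
L-functions (Godement–Jacquet), Artin L-functions and Brauer–Artin formalism, rigorous L-function
computation (Turing1953, Booker2006); the Galois side reuses the tree's Doud–Moore field
(DoudMoore2006). Booker (Booker2006 p. 8 and §6) certified Artin + RH to height 100 for
non-totally-real S₅ fields and wrote that totally real A₅ fields were "far too large to test";
Doud–Moore's field (2006) makes the even case testable, and nobody has pointed such a certificate at
a TYPED refutation of reciprocity: either outcome is new — a certified pole of L(s, σ) below height
200 proves ¬Langlands (and ¬Artin for σ = τ ⊗ τ^c of the first even icosahedral pair), a certified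
divisibility is the first verified instance of Dedekind's conjecture in its smallest open case and
calibrates every even-Artin route of the summit. The negatives index (RankinSelbergPoleCount,
SerreTypeAnchor, SplitPrimeInduction deinduction) is not touched: every prime set here is explicit
and no free function or datum is quantified.

RANKED CRUXES. #2 ZetaNonDivisor (crux) — [computational bet, `--computational`] For every number
field K of degree 5 containing a root of x⁵ − x⁴ − 780x³ + 9911x² − 24208x + 15952 (all such K are
isomorphic: the Doud–Moore A₅ quintic, disc 1951⁴) there is a zero s₀ of the Riemann zeta function
with 0 < Re s₀ < 1 and |Im s₀| ≤ 200 such that NO function holomorphic on {Re s > 0} ∖ {1} that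
agrees with the Dirichlet series ζ_K on Re s > 1 (i.e. the continued Dedekind zeta function; unique
by the identity theorem, exists by Hecke) vanishes within 10⁻⁶ of s₀. Instance set: the 79 zeros 1/2
+ iγ_n, 0 < γ_n ≤ 200 (conjugates by symmetry); certificate: for each n an Arb ball transcript of
ζ_K on a circle of radius 5·10⁻⁷ about 1/2 + iγ_n (argument-principle count, or a Rouché lower
bound) from the smoothed approximate functional equation with explicit truncation bounds;
TRUE-certificate = one n with count 0 on the disc of radius 10⁻⁶ + 10⁻⁹ (with the Riemann zero
isolated to 10⁻⁹) ⇒ with the other two cruxes ¬Langlands; FALSE-certificate = count ≥ 1 within 10⁻⁶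
− 10⁻⁹ for all 79 ⇒ route closes refuted:ZetaNonDivisor with the transcript as evidence (first
certified instance of Dedekind's conjecture for a totally real non-solvable quintic, to height 200).
Cost: 79 zeros × 40 evaluations × ≈2.3·10¹⁰ AFE terms (analytic conductor 1951⁴·((t+3)/2π)⁵ ≈ 5·10²⁰
at t = 200) ≈ 3,160 cases × 2,300 s ÷ 980 cores ≈ 2.1 h (≈ 84 core-days) + coefficient generation
(splitting types of p ≤ 2.3·10¹⁰, ≈ 1 core-day) + evaluator engineering (ccert seat). [difficulty:
L] (why it might fail: Langlands (indeed Artin for σ = τ⊗τ^c) is true: then ζ | ζ_K exactly and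
every Riemann zero carries a ζ_K zero at distance 0 — the census refutes the crux; a non-divisor
also needs a conspiracy of coincident zeros of the abelian Brauer pieces at a Riemann zero
(Stark1974, FooteWales1990).) [Booker2006, DoudMoore2006, Vanderwaall1975, Stark1974,
FooteWales1990, Platt2017, Turing1953, Hecke1917]
#3 CorrespondentDividesZeta (crux) — [the reduction theorem] For every number field K and every
Artin representation σ : Γ_ℚ → GL₄(ℂ) with 1 ⊕ σ ≅ Ind_{Γ_K}^{Γ_ℚ} 1 (`ArtinRep.IsInducedFrom`), and
every CUSPIDAL automorphic representation π of GL₄(𝔸_ℚ) (Borel–Jacquet datum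
`CuspidalAutomorphicRepData 4 ℚ hcpt`) with π_v = π(σ_v) at almost every place
(`ArtinAutomorphy.IsPiOfArtinRep σ π.1`: Satake polynomial = characteristic polynomial of arithmetic
Frobenius), there is Z : ℂ → ℂ holomorphic on {Re s > 0} ∖ {1}, equal to the Dirichlet series ζ_K on
Re s > 1, with Z(s₀) = 0 at every zero s₀ of ζ in the open critical strip. Chain: Artin formalism
ζ_K(s) = L(s, Ind 1) = L(s, 1 ⊕ σ) = ζ(s)·L(s, σ) on Re s > 1 (tree:
`artinLFunction_eq_of_isInducedFrom_holds`, `artinLFunction_prod`, `artinLFunction_congr`,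
`artinLFunction_trivial_eq_dedekindZeta_holds`, `dedekindZeta_rat_eq_riemannZeta`); π = π(σ) a.e. ⇒
L^S(s, π) = L^S(s, σ) for a finite S ⊇ ramified places; A_G-normalisation + L² realisation of π
(`exists_centerInvariant_hasSatakeParamAt_shift_eventually`, `exists_isAssociatedL2_holds`,
`hasSatakeParamAt_iff_L2`) and Godement–Jacquet for GL₄ (named fact `godementJacquet`, lang.S21;
`exists_entire_eq_partialStandardL_of_godementJacquet`, n ≥ 2) ⇒ L^S(s, σ) extends to an entire G;
the removed Euler factors are holomorphic and zero-free on Re s > 0, so L(s, σ) extends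
holomorphically to Re s > 0 and Z := ζ · (that extension) works. No functional equation, no
local–global compatibility, no archimedean type of π is used. [difficulty: L] (why it might fail: as
TYPED: `godementJacquet` (entire form) is an undischarged named fact (only the meromorphic form is
proved in tree), and the GL₄ Borel–Jacquet ↔ L² Satake transfer is assembled in tree only for GL₂
(Langlands–Tunnell bridge); a gap in `hasSatakeParamAt_iff_L2` at n = 4 would stall the proof.)
[GodementJacquet1972, JacquetShalikaAJM1981, BorelJacquetCorvallis1979, NeukirchANT1999,
Tunnell1981, MartinetDurham1977]
#4 QuinticAvatarSupply (crux) — [supply, Doud–Moore field + permutation representation] There are a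
number field K of degree 5 containing a root of the Doud–Moore quintic and an Artin representation σ
: Γ_ℚ → GL₄(ℂ) with 1 ⊕ σ ≅ Ind_{Γ_K}^{Γ_ℚ} 1, such that for every reciprocity datum RD of ℚ and
every prime ℓ ≠ 1951 there are ι : ℚ̄_ℓ ≃ ℂ and an ℓ-adic ρ : Γ_ℚ → GL₄(ℚ̄_ℓ) that is irreducible,
geometric in the summit's sense (`IsGeometricFramed RD ρ`: a.e. unramified; de Rham at ℓ for the
PINNED Fontaine datum — ρ is UNRAMIFIED at ℓ ≠ 1951, the case the structure axioms of
`PstWeilDeligneData` do cover, exactly as in the landed `IcosahedralSupply_away`), and such that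
every cuspidal typed correspondent π (`Corresponds RD ι π.1 ρ`) satisfies `IsPiOfArtinRep σ π.1`.
Witness: K = ℚ(θ₀) from the tree's `stub_dmGaloisDatum`/`doudMooreField` (five real roots, e : Γ_ℚ →
A₅ with open kernel, unramified away from 1951, inertia of order 5 above 1951, image containing
elements of orders 3 and 5 hence all of A₅); σ = permutation representation on the roots restricted
to the sum-zero lattice (integer matrices), irreducible because A₅ is doubly transitive; ρ = the
same integer matrices over ℚ̄_ℓ; `Corresponds` ⇒ cofinite `SatakeFrobCompatibleAt` ⇒ char poly of
arithmetic Frobenius of ρ = P_v ∈ ℤ[X] = that of σ, whose roots are roots of unity, so the Satake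
multiset {ι⁻¹(α_j⁻¹)} = roots(P_v) is inversion-closed and `satakePolynomial α = P_v`
(`FrobSatakeCompatibleAt`). [difficulty: M] (why it might fail: as TYPED: passing from
`arithFrobPolyOfSatake ι q 1 α` (ℓ-adic ρ) to `satakePolynomial α` (complex σ) needs the Satake
multiset pinned and inversion-closed, and `IsInducedFrom` (Mathlib `Representation.ind` along
`absGaloisRestrict`) must be witnessed for the permutation module — API risks.) [DoudMoore2006,
JonesRoberts2008, SerreLinearRepresentations1977, NeukirchANT1999, BuzzardGeeLMS2014]

TWO-LAYER PLAN. CorrespondentDividesZeta ⇐ ArtinFactorisation (ζ_K = ζ·L(σ) on Re s > 1, provable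
now from the proved Artin-formalism theorems) → CuspidalArtinHolomorphy (IsPiOfArtinRep σ π.1 with π
cuspidal on GL₄ ⇒ L(s, σ) extends holomorphically to Re s > 0; the GL₄ analogue of the tree's
`hasEntireContinuation_artinLFunction_of_isPiOfArtinRep_of_two_facts`, one-sided, no functional
equation) → CorrespondentDividesZeta (k = 2; Z := ζ·G; this is the BC3 birth skeleton).
QuinticAvatarSupply ⇐ QuinticArtinData (the Doud–Moore side: degree 5, 1 ⊕ σ ≅ Ind 1, integral
finite-image σ, irreducible, unramified away from 1951 — reuses `doudMooreField`) → ElladicAvatar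
(any integral, irreducible, finite-image σ unramified away from 1951 has, for ℓ ≠ 1951, an
irreducible geometric ℓ-adic avatar whose typed cuspidal correspondents are π(σ)'s) →
QuinticAvatarSupply (k = 2; birth skeleton). ZetaNonDivisor ⇐ RiemannZeroNearCentre (a certified
Riemann zero within 10⁻⁹ of the disc centre) → DedekindZeroFreeNearCentre (ζ_K zero-free on the
(10⁻⁶ + 10⁻⁹)-disc) → ZetaNonDivisor (triangle inequality; the centre is fixed by the census job).
Nothing here is filed now.

KILL CRITERIA. The census job returning, for all 79 Riemann zeros of height ≤ 200, a certified zero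
of ζ_K within 10⁻⁶ refutes ZetaNonDivisor: close `refuted:ZetaNonDivisor`, attach the Arb transcript
(certified Dedekind divisibility / Artin holomorphy for σ = τ⊗τ^c of the first even icosahedral
field to height 200) and hand CorrespondentDividesZeta / QuinticAvatarSupply on as supports: to
QuarterDeficit1951 (same field; its C1 census becomes the only live negation instance) and, as
calibration evidence, to the even-Artin proof routes (EvenArtinQuantumBoundary, HolomorphicShadow,
GaloisWeightedBE, EvenArtinGL4Door). A refutation of CorrespondentDividesZeta or QuinticAvatarSupply
by an API witness (Satake non-uniqueness, a `CuspidalAutomorphicRepData` that is not realisable in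
L²) is a STATEMENT-AUDIT finding on the accepted carriers, not a pivot: report needs-human. A proof
of strong Artin for the conductor-1951 icosahedral pair (any route), or a discharge of Dedekind's
conjecture for A₅ quintics in print, moots the line (the census then certifies a theorem and the
route is closed superseded).

NOT DECOMPOSED YET. The two pieces of CorrespondentDividesZeta and of QuinticAvatarSupply (above)
are layer-2 children, filed only when a prover claims the parent; the certificate format for
ZetaNonDivisor (Arb transcript of the smoothed-AFE evaluation with Booker-2006-type truncation
bounds + an independent re-evaluation, PARI `lfun` as non-rigorous cross-check) is a compute-infra
request for the `ccert` seat, not an item; no in-kernel checker is claimed (verdict class: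
computation). The instance set is deliberately ONE field: further totally real A₅/S₅ quintics
(Jones–Roberts tables) cost nothing extra analytically but each needs its own Galois-datum supply in
Lean; they are re-armed only if the census outcome warrants.

CHEAPEST FALSIFIER. (a) Lookup, run (2026-08-17): has ζ | ζ_K (equivalently holomorphy of L(s, σ) =
ζ_K/ζ) been certified for a totally real A₅ or S₅ quintic? Booker2006 (arXiv:math/0507502, read pp.
4, 8, 20–21): Artin + RH certified to height 100 for NON-totally-real S₅ fields only; p. 8: totally
real A₅ fields "far too large to test with current computers" (written before DoudMoore2006); no
later certificate found (crossref/zbMATH: "Dedekind conjecture quintic", "Artin L-functions small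
conductor" → JonesRoberts2017 tables assume Artin; Cimpoeaş–Nicolae 2020 arXiv:1909.03718 is
theoretical). (b) Toy, running: kit job j021822 (PARI `lfunzeros`, 64-bit, NON-rigorous) compares
the zeros of ζ_K below height 22 with the first two Riemann zeros; an earlier 57-digit attempt
j021789 was cancelled at lfuncost = 3.3·10⁹ coefficients. (c) The census job itself (≈ 2 h on the
lane once the certified evaluator exists) settles ZetaNonDivisor either way.

NUMBERS. K: x⁵ − x⁴ − 780x³ + 9911x² − 24208x + 15952, disc(f) = 2⁶·5⁶·73²·1951⁴, d_K = 1951⁴ =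
14,488,688,572,801 (PARI j021789: polgalois = A₅, signature (5,0), e = 1 at 2, 5, 73); splitting
types for p ≤ 113: only {5}, {3,1,1}, {2,2,1} (A₅ classes), f irreducible mod 3. σ: conductor 1951⁴
(inertia C₅ acts on σ without invariants), Γ-factor Γ_ℝ(s)⁴, L(s, σ) = ζ_K(s)/ζ(s) = L(s, τ × τ^c)
for the two even icosahedral τ, τ^c of conductor 1951 (A₅ 4-dim = tensor of the two SL₂(𝔽₅) 2-dims).
Riemann zeros with 0 < γ ≤ 200: N(200) = 79 (all simple, on the line; Platt–Trudgian). Analytic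
conductor of ζ_K at height t: 1951⁴((t+3)/2π)⁵ ≈ 5.1·10²⁰ at t = 200, AFE length ≈ 2.3·10¹⁰; ζ_K
zero density at t = 200 ≈ (1/2π)·log(5·10²⁰) ≈ 7.6 per unit, so δ = 10⁻⁶ is 10⁵ times finer than the
mean spacing (accidental false divisibility probability ≈ 10⁻³ over 79 discs). Booker2006
comparison: degree 6, conductor 3.6·10⁷, height 100, 2³² coefficients, one 3 GHz PC. Items at open:
4.

DEFINITION REQUESTS. compute-infra (to be filed by the `ccert` seat after open): an Arb-certified
evaluator of ζ_K(s) for a quintic field inside the critical strip (smoothed approximate functional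
equation with explicit truncation and Γ-factor bounds, Booker2006 §§3–5 / Platt2017 style;
coefficients from splitting types of p via gcd(x^(p^k) − x, f) as in Booker2006 §6.1) emitting ball
transcripts for argument-principle counts on small circles; verdict class `computation` (no kernel
checker claimed). No new Lean notions: `NumberField.dedekindZeta` (Mathlib), `riemannZeta`
(Mathlib), `FramedArtinRep`, `ArtinRep.IsInducedFrom`, `ContinuousRep.prod/trivial`,
`ArtinAutomorphy.IsPiOfArtinRep`, `CuspidalAutomorphicRepData`, `Corresponds`, `IsGeometricFramed`
all exist (lean search --decl). Cite facts wanted (already in tree as named facts):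
`godementJacquet` (lang.S21), `isDedekindZetaContinuation_dedekindZetaCont` (Hecke1917; NOT needed
by the glue — the census and the reduction are stated continuation-agnostically).

Novelty: Searches (2026-08-17): `lit read arxiv:math/0507502 --grep '1951|icosahedral|Dedekind|totally
real|S_5|A_5'` (Booker2006, 82 hits, pp. 4/8/20/21 read); `lit search --source crossref "Dedekind
conjecture quintic A5 zeta function holomorphic quotient"` (15: Vanderwaall1975, FooteWales1990);
`lit search --source crossref "Artin L-functions small conductor rigorous computation zeros Platt
Booker LMFDB"` (14: JonesRoberts2017 doi:10.1007/s40993-017-0079-5, Booker2003); `lit search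
--source zbmath "Dedekind conjecture Artin holomorphy quotient zeta functions"` (1: Cimpoeaş–Nicolae
arXiv:1909.03718); `lit galaxy search "Dedekind's conjecture" --star all` (7: MurtyMurty1997 book,
Steuding LNM 1877); local searchd / openalex / s2 unavailable (rc 1 / HTTP 429) this session; `lean
search dedekindZeta|ArtinConjecture|godementJacquet|IsPiOfArtinRep|IsInducedFrom` (tree API located:
DedekindZeta.lean, ArtinLFunctions.lean, AutomorphicLFunctions.lean, ArtinAutomorphy.lean,
ArtinFormalism*.lean, LanglandsTunnellBridge*.lean, BookerStrongArtin*.lean); all 52 open Langlands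
route headers listed (one negation route: QuarterDeficit1951); idea cards read:
artin-regime-heilbronn-blindness (positive-direction obstruction card, graded variant),
_closed/effective-booker-first-even-icosahedral (positive direction, closed known: Booker's
programme), bottom-eigenvalue-census (spectral census, variant); negatives index (3 entries) read.
Nearest prior art found: Booker2006 (arXiv:math/0507502) §6 — certif  [refs: 10.1007/s40993-017-0079-5, math/0507502, 1909.03718, arxiv:math/0507502, doi:10.1007/s40993-017-0079-5, Booker2006, Vanderwaall1975, FooteWales1990, Booker2003, MurtyMurty1997]

Barriers (technique_class: certified-computation, artin-l-functions, refutation): - technique_class: certified-computation, artin-l-functions, refutation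
- Literature.Barriers.Langlands.NonRegularWeightBarrier: evaded — nothing cohomological or p-adic is
used; the Hodge–Tate-weight-0 (even, Maass-type) sector is reached through standard L-functions
only, and the archimedean component of the correspondent is never needed (Godement–Jacquet holds for
every π_∞).
- Literature.Barriers.Langlands.SolvableImageBarrier: evaded — no base change along the
A₅-extension; the insoluble image enters only through the Artin formalism (induction from Γ_K, a
theorem) and a finite certified computation.
- Literature.Barriers.Langlands.ShimuraVarietyRealizationBarrier: not in this technique class — no
Galois representation is constructed from an automorphic one; the route runs (B) and the Satake
clause only.
- Literature.Barriers.Langlands.TaylorWilesNumericalCoincidence: not in this technique class (no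
patching, no deformation rings); likewise PatchingLocalComponentBarrier, ResiduallyReducibleBarrier,
TwistedEndoscopySelfDual, ShtukaConstantFieldBarrier, ModPLanglandsGL2BeyondQp are not engaged.
- Negatives index: 3 refuted statements (OrdinaryPrimeTransport.RankinSelbergPoleCount,
K3KugaSatakeDescent.SerreTypeAnchor, SplitPrimeInduction deinduction); none concerns Dedekind zeta
divisibility, Artin L-functions of the quintic or Godement–Jacquet; steered around their typing
lessons — every prime set here is explicit ({1951}, ℓ = 17, |Im s| ≤ 200) and no free datum or
function

Novelty grade: variant — route-review (refuter, in-hub duplication; not a full novelty audit): the SAME mechanism is already filed on this problem as route-Langlands-DedekindQuotient1951 (opened 2026-08-17T01:39:02Z, 32 min before this route, READY, 2/2 cruxes vetted): same Doud–Moore A₅ quintic (d=1951⁴), same reduction ty (refuter refuter-rreview-0817T02-3-0, 2026-08-17T02:34:44Z; prior: route-Langlands-DedekindQuotient1951, arXiv:math/0507502 (Booker2006 §6), DoudMoore2006 doi:10.1016/j.jnt.2005.08.008)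

History (route lifecycle, newest last):
- 2026-08-17T09:21:36Z · CLOSED superseded — superseded:route-Langlands-DedekindQuotient1951 (planner-rchoice-Langlands-DedekindDeficit1951--d6caad29-0)

sub-problem: Langlands · status: closed(superseded) · opened planner-plan-lens3-Langlands-finite-0 2026-08-17T02:10:57Z · rev 3 · ledger route-Langlands-DedekindDeficit1951
GENERATED by the gate from the ledger (D-0016/17). Provers cite these decls: `theorem foo : Summit.Langlands.Langlands.Theses.DedekindDeficit1951.<Decl> := …` in Summits/Langlands/Langlands/Theorems/<Name>.lean.
-/

namespace Summit.Langlands.Langlands.Theses.DedekindDeficit1951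

open scoped BigOperators Topology Manifold Classical MeasureTheory ProbabilityTheory Matrix InnerProductSpace ComplexConjugate ContinuousMap
open Filter Set Function TopologicalSpace MeasureTheory

attribute [summit_statement] _root_.Langlands

/-- item stmt-Langlands-17794 · crux · rank 2 · closed · moot by None · by planner
why it might fail: Langlands (indeed Artin for σ = τ⊗τ^c) is true: then ζ | ζ_K exactly and every Riemann zero carries a ζ_K zero at distance 0 — the census refutes the crux; a non-divisor also needs a conspiracy of coincident zeros of the abelian Brauer pieces at a Riemann zero (Stark1974, FooteWales1990).
sources: Booker2006, DoudMoore2006, Vanderwaall1975, Stark1974, FooteWales1990, Platt2017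
[crux] [computational bet, `--computational`] For every number field K of degree 5 containing a root
of x⁵ − x⁴ − 780x³ + 9911x² − 24208x + 15952 (all such K are isomorphic: the Doud–Moore A₅ quintic,
disc 1951⁴) there is a zero s₀ of the Riemann zeta function with 0 < Re s₀ < 1 and |Im s₀| ≤ 200
such that NO function holomorphic on {Re s > 0} ∖ {1} that agrees with the Dirichlet series ζ_K on
Re s > 1 (i.e. the continued Dedekind zeta function; unique by the identity theorem, exists by
Hecke) vanishes within 10⁻⁶ of s₀. Instance set: the 79 zeros 1/2 + iγ_n, 0 < γ_n ≤ 200 (conjugates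
by symmetry); certificate: for each n an Arb ball transcript of ζ_K on a circle of radius 5·10⁻⁷
about 1/2 + iγ_n (argument-principle count, or a Rouché lower bound) from the smoothed approximate
functional equation with explicit truncation bounds; TRUE-certificate = one n with count 0 on the
disc of radius 10⁻⁶ + 10⁻⁹ (with the Riemann zero isolated to 10⁻⁹) ⇒ with the other two cruxes
¬Langlands; FALSE-certificate = count ≥ 1 within 10⁻⁶ − 10⁻⁹ for all 79 ⇒ route closes
refuted:ZetaNonDivisor with the transcript as evidence (first certified instance of Dedekind's
conjecture for a totally real non-so -/
@[route_item "route-Langlands-DedekindDeficit1951"]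
def ZetaNonDivisor : Prop :=
  ∀ (K : Type) [Field K] [NumberField K], (∃ θ : K, θ ^ 5 - θ ^ 4 - 780 * θ ^ 3 + 9911 * θ ^ 2 - 24208 * θ + 15952 = 0) → Module.finrank ℚ K = 5 → ∃ s₀ : ℂ, riemannZeta s₀ = 0 ∧ 0 < s₀.re ∧ s₀.re < 1 ∧ |s₀.im| ≤ 200 ∧ ∀ Z : ℂ → ℂ, DifferentiableOn ℂ Z ({s : ℂ | 0 < s.re} \ {1}) → Set.EqOn Z (NumberField.dedekindZeta K) {s : ℂ | 1 < s.re} → ∀ s : ℂ, ‖s - s₀‖ < (1 / 10 ^ 6 : ℝ) → Z s ≠ 0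

/-- item stmt-Langlands-17795 · crux · rank 3 · closed · moot by None · by planner
why it might fail: as TYPED: `godementJacquet` (entire form) is an undischarged named fact (only the meromorphic form is proved in tree), and the GL₄ Borel–Jacquet ↔ L² Satake transfer is assembled in tree only for GL₂ (Langlands–Tunnell bridge); a gap in `hasSatakeParamAt_iff_L2` at n = 4 would stall the proof.
sources: GodementJacquet1972, JacquetShalikaAJM1981, BorelJacquetCorvallis1979, NeukirchANT1999, Tunnell1981, MartinetDurham1977
[crux] [the reduction theorem] For every number field K and every Artin representation σ : Γ_ℚ →
GL₄(ℂ) with 1 ⊕ σ ≅ Ind_{Γ_K}^{Γ_ℚ} 1 (`ArtinRep.IsInducedFrom`), and every CUSPIDAL automorphic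
representation π of GL₄(𝔸_ℚ) (Borel–Jacquet datum `CuspidalAutomorphicRepData 4 ℚ hcpt`) with π_v =
π(σ_v) at almost every place (`ArtinAutomorphy.IsPiOfArtinRep σ π.1`: Satake polynomial =
characteristic polynomial of arithmetic Frobenius), there is Z : ℂ → ℂ holomorphic on {Re s > 0} ∖
{1}, equal to the Dirichlet series ζ_K on Re s > 1, with Z(s₀) = 0 at every zero s₀ of ζ in the open
critical strip. Chain: Artin formalism ζ_K(s) = L(s, Ind 1) = L(s, 1 ⊕ σ) = ζ(s)·L(s, σ) on Re s > 1
(tree: `artinLFunction_eq_of_isInducedFrom_holds`, `artinLFunction_prod`, `artinLFunction_congr`,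
`artinLFunction_trivial_eq_dedekindZeta_holds`, `dedekindZeta_rat_eq_riemannZeta`); π = π(σ) a.e. ⇒
L^S(s, π) = L^S(s, σ) for a finite S ⊇ ramified places; A_G-normalisation + L² realisation of π
(`exists_centerInvariant_hasSatakeParamAt_shift_eventually`, `exists_isAssociatedL2_holds`,
`hasSatakeParamAt_iff_L2`) and Godement–Jacquet for GL₄ (named fact `godementJacquet`, lang.S21;
`exists_entire_eq_partialStandar -/
@[route_item "route-Langlands-DedekindDeficit1951"]
def CorrespondentDividesZeta : Prop :=
  ∀ (K : Type) [Field K] [NumberField K] (σ : Literature.NumberTheory.GaloisRepresentations.FramedArtinRep ℚ 4), Literature.NumberTheory.GaloisRepresentations.ArtinRep.IsInducedFrom (Literature.NumberTheory.GaloisRepresentations.ContinuousRep.prod (Literature.NumberTheory.GaloisRepresentations.ContinuousRep.trivial (Field.absoluteGaloisGroup ℚ) ℂ ℂ) σ.toArtinRep) (Literature.NumberTheory.GaloisRepresentations.ContinuousRep.trivial (Field.absoluteGaloisGroup K) ℂ ℂ) → ∀ (hcpt : Literature.NumberTheory.Automorphic.isCompact_glFiniteIntegralLevel 4 ℚ)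 (π : Literature.NumberTheory.Automorphic.CuspidalAutomorphicRepData 4 ℚ hcpt), Literature.NumberTheory.Automorphic.ArtinAutomorphy.IsPiOfArtinRep σ π.1 → ∃ Z : ℂ → ℂ, DifferentiableOn ℂ Z ({s : ℂ | 0 < s.re} \ {1}) ∧ Set.EqOn Z (NumberField.dedekindZeta K) {s : ℂ | 1 < s.re} ∧ ∀ s₀ : ℂ, 0 < s₀.re → s₀.re < 1 → riemannZeta s₀ = 0 → Z s₀ = 0

/-- item stmt-Langlands-17796 · crux · rank 4 · closed · moot by None · by planner
why it might fail: as TYPED: passing from `arithFrobPolyOfSatake ι q 1 α` (ℓ-adic ρ) to `satakePolynomial α` (complex σ) needs the Satake multiset pinned and inversion-closed, and `IsInducedFrom` (Mathlib `Representation.ind` along `absGaloisRestrict`) must be witnessed for the permutation module — API risks.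
sources: DoudMoore2006, JonesRoberts2008, SerreLinearRepresentations1977, NeukirchANT1999, BuzzardGeeLMS2014
[crux] [supply, Doud–Moore field + permutation representation] There are a number field K of degree
5 containing a root of the Doud–Moore quintic and an Artin representation σ : Γ_ℚ → GL₄(ℂ) with 1 ⊕
σ ≅ Ind_{Γ_K}^{Γ_ℚ} 1, such that for every reciprocity datum RD of ℚ and every prime ℓ ≠ 1951 there
are ι : ℚ̄_ℓ ≃ ℂ and an ℓ-adic ρ : Γ_ℚ → GL₄(ℚ̄_ℓ) that is irreducible, geometric in the summit's
sense (`IsGeometricFramed RD ρ`: a.e. unramified; de Rham at ℓ for the PINNED Fontaine datum — ρ is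
UNRAMIFIED at ℓ ≠ 1951, the case the structure axioms of `PstWeilDeligneData` do cover, exactly as
in the landed `IcosahedralSupply_away`), and such that every cuspidal typed correspondent π
(`Corresponds RD ι π.1 ρ`) satisfies `IsPiOfArtinRep σ π.1`. Witness: K = ℚ(θ₀) from the tree's
`stub_dmGaloisDatum`/`doudMooreField` (five real roots, e : Γ_ℚ → A₅ with open kernel, unramified
away from 1951, inertia of order 5 above 1951, image containing elements of orders 3 and 5 hence all
of A₅); σ = permutation representation on the roots restricted to the sum-zero lattice (integer
matrices), irreducible because A₅ is doubly transitive; ρ = the same integer matrices over ℚ̄_ℓ;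
`Corresponds` ⇒ cofinit -/
@[route_item "route-Langlands-DedekindDeficit1951"]
def QuinticAvatarSupply : Prop :=
  ∃ (K : Type) (_ : Field K) (_ : NumberField K) (σ : Literature.NumberTheory.GaloisRepresentations.FramedArtinRep ℚ 4), (∃ θ : K, θ ^ 5 - θ ^ 4 - 780 * θ ^ 3 + 9911 * θ ^ 2 - 24208 * θ + 15952 = 0) ∧ Module.finrank ℚ K = 5 ∧ Literature.NumberTheory.GaloisRepresentations.ArtinRep.IsInducedFrom (Literature.NumberTheory.GaloisRepresentations.ContinuousRep.prod (Literature.NumberTheory.GaloisRepresentations.ContinuousRep.trivial (Field.absoluteGaloisGroup ℚ) ℂ ℂ) σ.toArtinRep) (Literature.NumberTheory.GaloisRepresentations.ContinuousRep.trivial (Field.absoluteGaloisGroup K) ℂ ℂ) ∧ ∀ (RD : Summit.Langlands.ReciprocityData ℚ) (ℓ : ℕ) [Fact ℓ.Prime], ℓ ≠ 1951 → ∃ (ι : PadicAlgCl ℓ ≃+* ℂ) (ρ : Literature.NumberTheory.GaloisRepresentations.FramedGaloisRep ℚ (PadicAlgCl ℓ) 4), ρ.toGaloisRep.IsIrreducible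 ∧ Summit.Langlands.IsGeometricFramed RD ρ ∧ ∀ (hcpt : Literature.NumberTheory.Automorphic.isCompact_glFiniteIntegralLevel 4 ℚ) (π : Literature.NumberTheory.Automorphic.CuspidalAutomorphicRepData 4 ℚ hcpt), Summit.Langlands.Corresponds RD ι π.1 ρ → Literature.NumberTheory.Automorphic.ArtinAutomorphy.IsPiOfArtinRep σ π.1

/-- item stmt-Langlands-17797 · assembly · rank 1 · closed · moot by None · by planner
sources: BuzzardGeeLMS2014, GodementJacquet1972, DoudMoore2006, Booker2006
[assembly] ZetaNonDivisor → CorrespondentDividesZeta → QuinticAvatarSupply → ¬ Langlands (refutation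
shape; the deciding theorem `closes` proves exactly this). -/
@[route_item "route-Langlands-DedekindDeficit1951"]
def Assembly : Prop :=
  ZetaNonDivisor → CorrespondentDividesZeta → QuinticAvatarSupply → ¬ _root_.Langlands

end Summit.Langlands.Langlands.Theses.DedekindDeficit1951
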